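import Mathlib
import Literature.Geometry.Riemannian.ChangGurskyYangEuler
import HarnessLib

/-!
# ChernGaussBonnetFour

Topic `Literature/Geometry/Riemannian`. Named literature fact(s) relocated by the gate from `Summits/SmoothPoincare4/SmoothPoincare4/Theorems/EntropyRungCompactShrinkerGapChernGaussBonnet.lean`
(accept-time relocation of `[cite]`d propositions written inline in a Summits proposal; human ruling 2026-08-15).
Sources: Besse1987, ChangGurskyYang2003, Chern1944.

* `Literature.Geometry.Riemannian.chernGaussBonnet_four`
-/

namespace Literature.Geometry.Riemannian

open scoped Manifold ContDiff ENNReal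
open scoped Manifold ContDiff ENNReal
open Literature.Geometry.Lorentzian (PseudoRiemannianMetric)
open Literature.Geometry.Lorentzian.PseudoRiemannianMetric
open Literature.AlgebraicTopology.SingularHomology (relEuler)

/-- **The Chern–Gauss–Bonnet formula in dimension four** (Chern 1944: for a closed orientable
Riemannian manifold of even dimension, `∫_M Ω = χ(M)` with `Ω` the Pfaffian form of the
curvature; Besse 1987, 6.31: for a compact oriented Riemannian `4`-manifold
`χ(M) = (8π²)⁻¹ ∫_M (‖U‖² − ‖Z‖² + ‖W‖²) μ_g`, i.e. in tensor norms
`8π² χ(M) = ∫_M (¼|W|² − ½|E|² + R²/24) dV_g`; Chang–Gursky–Yang 2003, (0.4) p. 107 and (1.1)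
p. 111: for a smooth closed four-manifold, "`8π² χ(M⁴) = ∫ ¼|W|² dvol + ∫ σ₂(A) dvol`", where
`σ₂(A) = −½|E|² + R²/24` and `|W|² = W_{ijkl}W^{ijkl}`). STATED HERE, in the tree's vocabulary and
exactly as the standing hypothesis `hCGB` of `ChangGurskyYangEuler.lean`: for every compact
Hausdorff second countable `C^∞` `4`-manifold `M` modelled on `ℝ⁴` (closed: the charts are
boundaryless; not necessarily orientable or connected — Chang–Gursky–Yang apply (1.1) to `ℝP⁴`; the
non-orientable case follows from the oriented one on the orientation double cover, both sides
doubling) and every `C^∞` Riemannian metric `g` on `TM` with its Levi-Civita connection,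
`8π² χ(M) = ¼ (∫_M |W_g|² dV_g).toReal + ∫_M σ₂(A_g) dV_g`, where `χ(M) = relEuler ℤ ℤ M ∅ =
Σ_k (−1)^k rank_ℤ H_k(M; ℤ)` is the Euler characteristic of singular homology
(`EulerCharacteristicTriple.lean`), `∫|W_g|² dV_g = g.weylEnergy ∈ ℝ≥0∞` (`WeylEnergy.lean`, finite
here by `weylEnergy_lt_top`) and `∫σ₂(A_g) dV_g = g.sigma2WeylSchoutenIntegral`
(`ChangGurskyYangProofs.lean`), both against the Riemannian volume measure. Equivalent forms
(Chern's `∫Pf(Ω) = 4π²χ`, Besse's `32π²χ = ∫(|Rm|² − 4|Ric|² + R²)`, the `Q`-curvature form):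
`chernGaussBonnet_four_tfae` (`ChernGaussBonnetFourForms.lean`); checked on the round `S⁴`:
`chernGaussBonnet_roundMetric_sphere_four`. A deep theorem (Chern–Weil theory + de Rham theorem +
de Rham/singular comparison): no `_holds` yet. The scoped notations `𝓡 4` (`Manifold`) and `∞`
(`ContDiff`) are written out (`modelWithCornersSelf ℝ (EuclideanSpace ℝ (Fin 4))`,
`((⊤ : ℕ∞) : WithTop ℕ∞)`) so that the statement parses without any `open scoped`; the term is
syntactically the type of the hypothesis `hCGB` of
`changGurskyYang_theoremA_of_chernGaussBonnet_of_margerin_of_thm14` (binders `(M : Type)`,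
`[IsManifold (𝓡 4) ∞ M]`, `[CompactSpace M]`, `g : PseudoRiemannianMetric (𝓡 4) ∞ ℝ⁴ TM`,
`[g.HasLeviCivita]`, `g.IsRiemannian`).
[cite: Besse1987, 6.31 (p. 161)] [cite: ChangGurskyYang2003, (1.1) p. 111] [cite: Chern1944]
[file Geometry/Riemannian/ChernGaussBonnetFour] -/
def chernGaussBonnet_four : Prop :=
  ∀ (M : Type) [TopologicalSpace M] [T2Space M] [SecondCountableTopology M]
    [ChartedSpace (EuclideanSpace ℝ (Fin 4)) M]
    [IsManifold (modelWithCornersSelf ℝ (EuclideanSpace ℝ (Fin 4))) ((⊤ : ℕ∞) : WithTop ℕ∞) M]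
    [CompactSpace M]
    (g : Literature.Geometry.Lorentzian.PseudoRiemannianMetric
      (modelWithCornersSelf ℝ (EuclideanSpace ℝ (Fin 4))) ((⊤ : ℕ∞) : WithTop ℕ∞)
      (EuclideanSpace ℝ (Fin 4))
      (TangentSpace (modelWithCornersSelf ℝ (EuclideanSpace ℝ (Fin 4))) : M → Type _))
    [g.HasLeviCivita], g.IsRiemannian →
    8 * Real.pi ^ 2 * (Literature.AlgebraicTopology.SingularHomology.relEuler ℤ ℤ M ∅ : ℝ) =
      1 / 4 * g.weylEnergy.toReal + g.sigma2WeylSchoutenIntegral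

/-! ## The stub, conditional on the fact -/

end Literature.Geometry.Riemannian
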